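import Literature.Computation.Certificates.PackedGramCertificateRows

/-!
# Packed Gram certificates: the INDEXED residual walk (a kernel hash law)

Compute-infrastructure file (cell certnum, seat certnum-sdp-3), a companion of
`PackedGramCertificateRows.lean`. It changes NOTHING in the certificate format, the checked
arithmetic or the meaning (`PSD.IsGramCertZ` of `intMatrixRows n w Arows`); it only changes HOW the
kernel term of each residual entry is spelled, and proves that the new check implies the old one.

## The kernel hash law (measured 2026-08-27, Lean `v4.32.0`, `decide +kernel`)

Lean hashes a natural-number literal by its low 64 bits (`instHashableNat : hash n := UInt64.ofNat n`,
used by `Lean.Literal.hash`, hence by the structural hash of every `Expr` containing the literal).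
The kernel's type checker memoises weak-head normal forms in hash tables keyed by that structural
hash. Consequently two DISTINCT big literals that agree modulo `2^64` — for a packed row literal:
two rows whose lowest `⌊64 / w⌋` packed entries coincide, e.g. rows of a sparse Gram matrix whose
first three entries vanish — make EVERY pair of kernel terms built over them in the same shape collide,
and each cache probe on such a term degrades to a linear scan of its collision class with structural
term comparison. The cost is quadratic in the class size and is pure bookkeeping (no arithmetic):

* synthetic (`S : List ℕ → ℕ`, four GMP `div`/`mod` per element, elements ≈ 264 bits):
  `N = 1000` elements all `≡ 12345 (mod 2^64)`: 16.96 s; the same elements made pairwise distinct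
  modulo `2^64`: 1.56 s. `N = 2000`: 88.5 s versus 2.38 s. `N = 400`: 2.66 s versus 1.02 s;
* the production case that exposed it (a `28 × 28` principal sub-block at offset 22 of gridfusion's
  `#50` 189-block, rounded twin with `w = 19`-bit row digits: the 28 row literals fall in only 4
  classes modulo `2^64`, the largest of size 25; the 28 compact factor columns in 15 classes, the
  largest of size 14): ONE `checkRows` decide 11.1–11.7 s, of which ≈ 2.3 s module/data elaboration;
  the SAME numerals through `checkRowsHead` + `checkRowsRange … 0 28` 3.1 s; bisection (local
  variants, same data): factor row by index / row literal by pattern 4.6 s, row literal by index /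
  factor row by pattern 9.2 s, both by pattern but each wrapped in an index-carrying identity
  (`salt i a := a`) 3.07 s — i.e. the lockstep pattern walk of `ddAllL` is not slow per se; the
  identity (hash) of the argument TERMS is what matters.

`ddAllL` (the residual walk of `checkRows`) binds the row literal `Aᵢ` and the expanded factor row
`qᵢ` by PATTERN, so the work terms `rowEntry w Aᵢ j`, `wdot X XM O D qᵢ qⱼ`, … mention the colliding
literals directly. The INDEXED walk below spells every such term through `Arows.getD i 0`,
`P.getD i _`, `P.getD j _`: the indices `i`, `j` (unary successor towers, structurally distinct) enter
the hash, no two work terms of different `(i, j)` collide whatever the data, and the list look-ups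
cost nothing extra because `P.getD j _` is the SAME term in every row (one memoised walk per `j`).
Split files (`checkRowsRange`) already index the row (`ddRangeL`); `checkRowsRangeI` indexes the
column too (immune to factor-column classes as well).

## API (namespace `Literature.Computation.Certificates.PSD.Packed`)

* `resRowI`, `ddRangeI`, `checkRowsI` (one piece), `checkRowsRangeI` (rows `lo … lo+cnt−1`);
* bridges `checkRows_of_checkRowsI`, `checkRowsRange_of_checkRowsRangeI` (file-private steps
  `resRowI_eq_resRowL`, `ddAllL_of_ddRangeI`, `ddRangeL_of_ddRangeI`) — so every downstream theorem stated
  with `checkRows … = true` / `RangesOK …` is fed from indexed decides unchanged;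
* corollary `isGramCertZ_of_checkRowsI`; kernel-checked `example`s (size 3) at the end.

RULE for emitters (certsdp.sos `packed.py`, any Kronecker-packing lane): decide `checkRowsI` /
`checkRowsRangeI`, never the pattern-walk `checkRows`, unless the packed literals are known to be
pairwise distinct modulo `2^64`.

WHAT IS NOT CERTIFIED: nothing new is certified here — the conclusions are those of
`PackedGramCertificateRows.lean` (positive semidefiniteness of exactly `toMatrixRows n w den Arows`
via `IsGramCertZ`); the timing law above is a measurement, not a theorem.

## References

* D. Harvey, *Faster polynomial multiplication via multipoint Kronecker substitution*, J. Symb.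
  Comput. 44 (2009), §3.1. [Harvey2009]
* G. Blekherman, P. Parrilo, R. Thomas (eds.), *Semidefinite Optimization and Convex Algebraic
  Geometry*, SIAM 2012, App. A.1.2. [BlekhermanParriloThomas2012]
-/

namespace Literature.Computation.Certificates

namespace PSD.Packed

/-! ### The indexed walk -/

/-- Residual row against the row literal `Ai` and the expanded factor row `qi`, entries
`j, j+1, …` (fuel `k`), the factor row of column `j` read BY INDEX (`P.getD j _`):
`A_ij − Σ_k d_k B_ki B_kj`. [folklore] -/
def resRowI (w X XM O D : ℕ) (P : List Row) (Ai : ℕ) (qi : Row) : ℕ → ℕ → List ℤ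
  | 0, _ => []
  | k + 1, j => (rowEntry w Ai j - wdot X XM O D qi (P.getD j ⟨0, 0, 0⟩)) ::
      resRowI w X XM O D P Ai qi k (j + 1)

/-- Diagonal dominance of the residual rows `i, i+1, …` (fuel `k`), row literal, own factor row
and column factor rows all read BY INDEX (`n` = number of columns). [folklore] -/
def ddRangeI (n w X XM O D : ℕ) (P : List Row) (Arows : List ℕ) : ℕ → ℕ → Bool
  | 0, _ => true
  | k + 1, i => ddRowOK i (resRowI w X XM O D P (Arows.getD i 0) (P.getD i ⟨0, 0, 0⟩) n 0) &&
      ddRangeI n w X XM O D P Arows k (i + 1)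

/-- **The packed Gram certificate check, rows layout, INDEXED walk**: the conjuncts of `checkRows`
(`den > 0`, `n` row literals, symmetry, no-carry bound, every compact factor row expands, `n`
expanded rows) with the diagonal-dominance walk `ddRangeI` over all `n` rows. Same certificate,
same meaning (`checkRows_of_checkRowsI`); immune to literal hash classes. Discharge by
`decide +kernel`. [folklore] -/
def checkRowsI (n w den v x O : ℕ) (Arows d Crows : List ℕ) : Bool :=
  let X := 2 ^ x
  let m := d.length
  decide (0 < den) && (Arows.length == n) && symmAllL w Arows 0 Arows &&
    decide (m * maxList d * (2 * O) ^ 2 < X) &&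
    match expandRows (2 ^ v) X (2 * O) d Crows with
    | none => false
    | some P => (P.length == n) && ddRangeI n w X (X ^ (m - 1)) O (sumList d) P Arows n 0

/-- **One INDEXED range of the rows check**: the compact factor rows expand to `n` rows and the
residual rows `lo … lo+cnt−1` are diagonally dominant, everything read by index. Implies
`checkRowsRange … lo cnt` (`checkRowsRange_of_checkRowsRangeI`), so `RangesOK` facts are fed from
these decides. [folklore] -/
def checkRowsRangeI (n w v x O : ℕ) (Arows d Crows : List ℕ) (lo cnt : ℕ) : Bool :=
  let X := 2 ^ x
  let m := d.length
  match expandRows (2 ^ v) X (2 * O) d Crows with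
  | none => false
  | some P => (P.length == n) && ddRangeI n w X (X ^ (m - 1)) O (sumList d) P Arows cnt lo

/-! ### Bridges to the pattern walk -/

/-- The indexed residual row over the suffix `P.drop j` (fuel = its length) IS the pattern-walk
residual row `resRowL` of `PackedGramCertificateRows.lean`. [folklore] -/
private theorem resRowI_eq_resRowL (w X XM O D : ℕ) (P : List Row) (Ai : ℕ) (qi : Row) :
    ∀ (qs : List Row) (j : ℕ), P.drop j = qs →
      resRowI w X XM O D P Ai qi qs.length j = resRowL w X XM O D Ai qi j qs
  | [], j, _ => by simp [resRowI, resRowL]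
  | q :: qs, j, h => by
      have hq : P.getD j ⟨0, 0, 0⟩ = q := by
        rw [List.getD_eq_getElem?_getD, ← Nat.add_zero j, ← List.getElem?_drop, h]
        simp
      have ht : P.drop (j + 1) = qs := by
        rw [← List.tail_drop, h, List.tail_cons]
      simp only [resRowI, resRowL, List.length_cons, hq]
      rw [resRowI_eq_resRowL w X XM O D P Ai qi qs (j + 1) ht]

/-- The indexed walk over the rows `i, i+1, …` implies the lockstep pattern walk `ddAllL` over the
suffixes `Arows.drop i`, `P.drop i` (when `P` has `n` rows). [folklore] -/
private theorem ddAllL_of_ddRangeI (n w X XM O D : ℕ) (P : List Row) (Arows : List ℕ) (hP : P.length = n) :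
    ∀ (As : List ℕ) (qs : List Row) (i : ℕ), Arows.drop i = As → P.drop i = qs →
      As.length = qs.length → ddRangeI n w X XM O D P Arows qs.length i = true →
      ddAllL w X XM O D P i As qs = true
  | [], [], _, _, _, _, _ => by simp [ddAllL]
  | [], _ :: _, _, _, _, hl, _ => by simp at hl
  | _ :: _, [], _, _, _, hl, _ => by simp at hl
  | Ai :: As, qi :: qs, i, hA, hQ, hl, h => by
      simp only [List.length_cons, ddRangeI, Bool.and_eq_true] at h
      have hAi : Arows.getD i 0 = Ai := by
        rw [List.getD_eq_getElem?_getD, ← Nat.add_zero i, ← List.getElem?_drop, hA]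
        simp
      have hqi : P.getD i ⟨0, 0, 0⟩ = qi := by
        rw [List.getD_eq_getElem?_getD, ← Nat.add_zero i, ← List.getElem?_drop, hQ]
        simp
      have hrow : resRowI w X XM O D P (Arows.getD i 0) (P.getD i ⟨0, 0, 0⟩) n 0 =
          resRowL w X XM O D Ai qi 0 P := by
        rw [hAi, hqi, ← hP]
        exact resRowI_eq_resRowL w X XM O D P Ai qi P 0 List.drop_zero
      have hA' : Arows.drop (i + 1) = As := by rw [← List.tail_drop, hA, List.tail_cons]
      have hQ' : P.drop (i + 1) = qs := by rw [← List.tail_drop, hQ, List.tail_cons]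
      simp only [ddAllL, Bool.and_eq_true]
      exact ⟨hrow ▸ h.1, ddAllL_of_ddRangeI n w X XM O D P Arows hP As qs (i + 1) hA' hQ'
        (by simpa using hl) h.2⟩

/-- The fully indexed walk implies the row-indexed walk `ddRangeL` of the split lane (when `P` has
`n` rows). [folklore] -/
private theorem ddRangeL_of_ddRangeI (n w X XM O D : ℕ) (P : List Row) (Arows : List ℕ) (hP : P.length = n) :
    ∀ (k i : ℕ), ddRangeI n w X XM O D P Arows k i = true → ddRangeL w X XM O D P Arows k i = true
  | 0, _, _ => by simp [ddRangeL]
  | k + 1, i, h => by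
      simp only [ddRangeI, Bool.and_eq_true] at h
      have hrow : resRowI w X XM O D P (Arows.getD i 0) (P.getD i ⟨0, 0, 0⟩) n 0 =
          resRowL w X XM O D (Arows.getD i 0) (P.getD i ⟨0, 0, 0⟩) 0 P := by
        rw [← hP]
        exact resRowI_eq_resRowL w X XM O D P _ _ P 0 List.drop_zero
      simp only [ddRangeL, Bool.and_eq_true]
      exact ⟨hrow ▸ h.1, ddRangeL_of_ddRangeI n w X XM O D P Arows hP k (i + 1) h.2⟩

/-- **`checkRowsI ⇒ checkRows`**: the indexed one-piece check implies the pattern-walk check of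
`PackedGramCertificateRows.lean`, so every theorem stated with `checkRows … = true` is fed from a
`checkRowsI` decide. [cite: BlekhermanParriloThomas2012, App. A.1.2] -/
theorem checkRows_of_checkRowsI {n w den v x O : ℕ} {Arows d Crows : List ℕ}
    (h : checkRowsI n w den v x O Arows d Crows = true) :
    checkRows n w den v x O Arows d Crows = true := by
  unfold checkRowsI at h
  unfold checkRows
  simp only [Bool.and_eq_true, beq_iff_eq, decide_eq_true_eq] at h ⊢
  obtain ⟨⟨⟨⟨hden, hlen⟩, hsym⟩, hbound⟩, hrest⟩ := h
  refine ⟨⟨⟨⟨hden, hlen⟩, hsym⟩, hbound⟩, ?_⟩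
  split at hrest
  · simp at hrest
  · rename_i P hP
    simp only [hP, Bool.and_eq_true, beq_iff_eq] at hrest ⊢
    obtain ⟨hPn, hdd⟩ := hrest
    refine ⟨hPn, ddAllL_of_ddRangeI n w _ _ O _ P Arows hPn Arows P 0 List.drop_zero
      List.drop_zero (by rw [hlen, hPn]) ?_⟩
    rw [hPn]
    exact hdd

/-- **`checkRowsRangeI ⇒ checkRowsRange`**: an indexed range decide feeds the `RangesOK` assembly of
`PackedGramCertificateRows.lean` (`isGramCertZ_of_checkRowsRanges`). [cite: BlekhermanParriloThomas2012, App. A.1.2] -/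
theorem checkRowsRange_of_checkRowsRangeI {n w v x O : ℕ} {Arows d Crows : List ℕ} {lo cnt : ℕ}
    (h : checkRowsRangeI n w v x O Arows d Crows lo cnt = true) :
    checkRowsRange w v x O Arows d Crows lo cnt = true := by
  simp only [checkRowsRangeI, checkRowsRange] at h ⊢
  split at h
  · simp at h
  · rename_i P hP
    simp only [hP, Bool.and_eq_true, beq_iff_eq] at h ⊢
    exact ddRangeL_of_ddRangeI n w _ _ O _ P Arows h.1 cnt lo h.2

/-- **Soundness of the indexed one-piece check** (corollary): the integer rounded Gram certificate
for `intMatrixRows n w Arows`, weights `weights d`, factor `factorRows v O d Crows n`.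
[cite: BlekhermanParriloThomas2012, App. A.1.2] -/
theorem isGramCertZ_of_checkRowsI {n w den v x O : ℕ} {Arows d Crows : List ℕ}
    (h : checkRowsI n w den v x O Arows d Crows = true) :
    IsGramCertZ (intMatrixRows n w Arows) (weights d) (factorRows v O d Crows n) :=
  isGramCertZ_of_checkRows (checkRows_of_checkRowsI h)

/-! ### Tests / usage templates (kernel-checked) -/

/-- Test data (as in `PackedGramCertificateRows.lean`): rows of `[[2,-1,0],[-1,2,-1],[0,-1,2]]`,
`4` bits per entry (offset `8`). [folklore] -/
private def testI_A : List ℕ :=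
  [2170, 1959, 2680]

/-- Test data: compact columns of the factor `[[1,-1,0],[0,1,-1],[0,0,1]]` (`3`-bit digits,
offset `2`). [folklore] -/
private def testI_C : List ℕ :=
  [147, 153, 202]

/-- Test: the INDEXED one-piece check passes in the kernel … -/
example : checkRowsI 3 4 1 3 7 2 testI_A [1, 1, 1] testI_C = true := by
  decide +kernel

/-- … and feeds the `checkRows`-stated API (here: positive semidefiniteness over `ℝ`). -/
example : ((toMatrixRows 3 4 1 testI_A).map (Rat.cast : ℚ → ℝ)).PosSemidef :=
  posSemidef_of_checkRows (v := 3) (x := 7) (O := 2) (d := [1, 1, 1]) (Crows := testI_C)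
    (checkRows_of_checkRowsI (by decide +kernel))

/-- Test: two INDEXED ranges `[0,2) ∪ [2,3)` feed the split assembly `isGramCertZ_of_checkRowsRanges`. -/
example : IsGramCertZ (intMatrixRows 3 4 testI_A) (weights [1, 1, 1]) (factorRows 3 2 [1, 1, 1] testI_C 3) :=
  isGramCertZ_of_checkRowsRanges (den := 1) (x := 7) (cnts := [2, 1]) (by decide +kernel)
    ⟨checkRowsRange_of_checkRowsRangeI (n := 3) (by decide +kernel),
     checkRowsRange_of_checkRowsRangeI (n := 3) (by decide +kernel), trivial⟩ (by norm_num)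

/-- Test: a planted defect (last row literal `2680 ↦ 2424`, entry `(2,2)` `2 ↦ 1`) is rejected by
the indexed check (the residual row `2` fails diagonal dominance). -/
example : checkRowsI 3 4 1 3 7 2 [2170, 1959, 2424] [1, 1, 1] testI_C = false := by
  decide +kernel

/-! ### The two one-piece checks are the SAME Boolean; measured cost of the indexed spelling (APPEND 2026-08-27)

`checkRowsI` and `checkRows` agree on every input (`checkRowsI_eq_checkRows` below): they differ only in
the SPELLING of the kernel work terms, so a client may decide either and rewrite to the other. MEASURED at
production size WITHOUT literal hash classes (gridfusion `#50`'s 189-block implicit twin, the check alone,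
same farm node, sequential, 2026-08-27): `checkRows` 54.1 s, `checkRowsI` 59.4 s — every memoised
`P.getD j _` look-up hits the cache in every row, but each hit compares the unary column-index towers
structurally, ≈ +10 %; WITH classes (the `28 × 28` block of the header) 11.1 s → 3.4 s. Hence an emitter
picks the indexed spelling when the packed numerals it would expose have a low-64-bit class of size `≥ 3`
and the pattern spelling otherwise (certsdp.sos 0.1.6: `INDEXED_DEFAULT = "auto"`). A second pitfall
measured the same day: two separate `decide +kernel` proofs in one file do NOT share the kernel's memo
tables — splitting `(checkRows … && packable …) = true` over an in-kernel-computed row list (`PSD.twinOf`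
of `PsdImplicitTwin.lean`) into two decides computes those rows twice (+33 s at `n = 189`); decide
`(checkRowsI … && packable …) = true` ONCE and bridge with `checkRows_of_checkRowsI`. -/

/-- Semantics of the lockstep pattern walk `ddAllL` over suffixes: if it passes from row `i` on the
suffixes `Arows.drop i`, `P.drop i` (with `P` of length `n`), the fully indexed walk passes on the same rows.
[folklore] -/
private theorem ddRangeI_of_ddAllL (n w X XM O D : ℕ) (P : List Row) (Arows : List ℕ) (hP : P.length = n) :
    ∀ (As : List ℕ) (qs : List Row) (i : ℕ), Arows.drop i = As → P.drop i = qs →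
      ddAllL w X XM O D P i As qs = true → ddRangeI n w X XM O D P Arows qs.length i = true
  | [], [], _, _, _, _ => by simp [ddRangeI]
  | [], _ :: _, _, _, _, h => by simp [ddAllL] at h
  | _ :: _, [], _, _, _, h => by simp [ddAllL] at h
  | Ai :: As, qi :: qs, i, hA, hQ, h => by
      simp only [ddAllL, Bool.and_eq_true] at h
      have hAi : Arows.getD i 0 = Ai := by
        rw [List.getD_eq_getElem?_getD, ← Nat.add_zero i, ← List.getElem?_drop, hA]
        simp
      have hqi : P.getD i ⟨0, 0, 0⟩ = qi := by
        rw [List.getD_eq_getElem?_getD, ← Nat.add_zero i, ← List.getElem?_drop, hQ]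
        simp
      have hrow : resRowI w X XM O D P (Arows.getD i 0) (P.getD i ⟨0, 0, 0⟩) n 0 =
          resRowL w X XM O D Ai qi 0 P := by
        rw [hAi, hqi, ← hP]
        exact resRowI_eq_resRowL w X XM O D P Ai qi P 0 List.drop_zero
      have hA' : Arows.drop (i + 1) = As := by rw [← List.tail_drop, hA, List.tail_cons]
      have hQ' : P.drop (i + 1) = qs := by rw [← List.tail_drop, hQ, List.tail_cons]
      simp only [List.length_cons, ddRangeI, Bool.and_eq_true]
      exact ⟨hrow ▸ h.1, ddRangeI_of_ddAllL n w X XM O D P Arows hP As qs (i + 1) hA' hQ' h.2⟩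

/-- **`checkRows ⇒ checkRowsI`** (the converse bridge). [cite: BlekhermanParriloThomas2012, App. A.1.2] -/
theorem checkRowsI_of_checkRows {n w den v x O : ℕ} {Arows d Crows : List ℕ}
    (h : checkRows n w den v x O Arows d Crows = true) :
    checkRowsI n w den v x O Arows d Crows = true := by
  unfold checkRows at h
  unfold checkRowsI
  simp only [Bool.and_eq_true, beq_iff_eq, decide_eq_true_eq] at h ⊢
  obtain ⟨⟨⟨⟨hden, hlen⟩, hsym⟩, hbound⟩, hrest⟩ := h
  refine ⟨⟨⟨⟨hden, hlen⟩, hsym⟩, hbound⟩, ?_⟩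
  split at hrest
  · simp at hrest
  · rename_i P hP
    simp only [hP, Bool.and_eq_true, beq_iff_eq] at hrest ⊢
    obtain ⟨hPn, hdd⟩ := hrest
    refine ⟨hPn, ?_⟩
    have := ddRangeI_of_ddAllL n w _ _ O _ P Arows hPn Arows P 0 List.drop_zero List.drop_zero hdd
    rwa [hPn] at this

/-- **The indexed and the pattern-walk one-piece checks are the same Boolean function** (they differ only
in how the kernel work terms are spelled). [cite: BlekhermanParriloThomas2012, App. A.1.2] -/
theorem checkRowsI_eq_checkRows (n w den v x O : ℕ) (Arows d Crows : List ℕ) :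
    checkRowsI n w den v x O Arows d Crows = checkRows n w den v x O Arows d Crows := by
  rw [Bool.eq_iff_iff]
  exact ⟨checkRows_of_checkRowsI, checkRowsI_of_checkRows⟩

/-- Test: the equality instantiated on the `3 × 3` data (both sides evaluate to `true`), and on the
planted defect (both `false`) — by the theorem, not by evaluation. -/
example : checkRowsI 3 4 1 3 7 2 [2170, 1959, 2424] [1, 1, 1] testI_C =
    checkRows 3 4 1 3 7 2 [2170, 1959, 2424] [1, 1, 1] testI_C :=
  checkRowsI_eq_checkRows ..

/-! ### The SYMMETRY pass and the FACTOR EXPANSION are exposed too: fully salted checks `checkRowsS` / `checkRowsHeadS` / `checkRowsRangeS` (APPEND 2, 2026-08-27)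

`checkRowsI` indexes the diagonal-dominance walk but still runs `symmAllL` (row literals by PATTERN) and
`expandRows` (factor-column literals by PATTERN). MEASURED on a block-diagonal `120 × 120` twin (two
dense `60`-blocks: the shipped row numerals of the second block start with sixty zero entries — a low-64-bit
class of 60 rows; likewise 60 factor columns), farm walls: data elaboration 21.1 s; `symmAllL` alone
**89.3 s**; `checkRowsHead` (symmetry + expansion + bound) **161.8 s** — on a dense block of that size both
are about a second. Below, EVERY literal that enters a kernel work term is salted with its index through
`salt i a := a` (symmetry: row `i` and row `j`; expansion: column `i`) or read by index (the walk of
`ddRangeI`): `symmAllS`, `expandRowsS`, `checkRowsHeadS`, `checkRowsS`, `checkRowsRangeS`. They are the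
SAME Boolean functions as `symmAllL`, `expandRows`, `checkRowsHead`, `checkRowsI`, `checkRowsRangeI`
(`…_eq` lemmas, by unfolding `salt`), hence the bridges to `checkRows` / `checkRowsHead` / `checkRowsRange`.
Emitters (certsdp.sos ≥ 0.1.6rc2): decide the `S` forms. -/

/-- Index-carrying identity: `salt i a` unfolds to `a`; the TERM mentions `i`. [folklore] -/
def salt (_i a : ℕ) : ℕ := a

/-- Symmetry of row `i` (literal `Ai`) against rows `j, j+1, … < i` of the list, each row literal SALTED
with its index `j`. Same function as `symmRowL` (`symmRowS_eq`). [folklore] -/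
def symmRowS (w i Ai : ℕ) : List ℕ → ℕ → Bool
  | [], _ => true
  | Aj :: As, j => if j < i then (rowEntry w Ai j == rowEntry w (salt j Aj) i) && symmRowS w i Ai As (j + 1) else true

/-- Symmetry of the whole matrix, every row literal salted with its index. Same function as `symmAllL`
(`symmAllS_eq`). [folklore] -/
def symmAllS (w : ℕ) (A : List ℕ) : ℕ → List ℕ → Bool
  | _, [] => true
  | i, Ai :: As => symmRowS w i (salt i Ai) A 0 && symmAllS w A (i + 1) As

/-- Expansion of all compact factor rows, column literal `i` salted with `i`. Same function as
`expandRows` (`expandRowsS_eq`). [folklore] -/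
def expandRowsS (V X Amax : ℕ) (d : List ℕ) : ℕ → List ℕ → Option (List Row)
  | _, [] => some []
  | i, c :: cs =>
      match expandRow V X Amax d (salt i c) 0 1 0 0, expandRowsS V X Amax d (i + 1) cs with
      | some q, some qs => some (q :: qs)
      | _, _ => none

/-- `symmRowS` is `symmRowL`. [folklore] -/
private theorem symmRowS_eq (w i Ai : ℕ) : ∀ (As : List ℕ) (j : ℕ), symmRowS w i Ai As j = symmRowL w i Ai As j
  | [], _ => by simp [symmRowS, symmRowL]
  | Aj :: As, j => by
      simp only [symmRowS, symmRowL, salt, symmRowS_eq w i Ai As (j + 1)]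

/-- `symmAllS` is `symmAllL`. [folklore] -/
private theorem symmAllS_eq (w : ℕ) (A : List ℕ) : ∀ (i : ℕ) (As : List ℕ), symmAllS w A i As = symmAllL w A i As
  | _, [] => by simp [symmAllS, symmAllL]
  | i, Ai :: As => by
      simp only [symmAllS, symmAllL, salt, symmRowS_eq, symmAllS_eq w A (i + 1) As]

/-- `expandRowsS` is `expandRows`. [folklore] -/
private theorem expandRowsS_eq (V X Amax : ℕ) (d : List ℕ) :
    ∀ (i : ℕ) (cs : List ℕ), expandRowsS V X Amax d i cs = expandRows V X Amax d cs
  | _, [] => by simp [expandRowsS, expandRows]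
  | i, c :: cs => by
      cases h₁ : expandRow V X Amax d c 0 1 0 0 <;> cases h₂ : expandRows V X Amax d cs <;>
        simp only [expandRowsS, expandRows, salt, expandRowsS_eq V X Amax d (i + 1) cs, h₁, h₂]

/-- **Head of the rows check, fully SALTED** (symmetry and expansion): same function as `checkRowsHead`
(`checkRowsHeadS_eq`). Discharge by `decide +kernel`. [folklore] -/
def checkRowsHeadS (n w den v x O : ℕ) (Arows d Crows : List ℕ) : Bool :=
  let X := 2 ^ x
  let m := d.length
  decide (0 < den) && (Arows.length == n) && symmAllS w Arows 0 Arows &&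
    decide (m * maxList d * (2 * O) ^ 2 < X) &&
    match expandRowsS (2 ^ v) X (2 * O) d 0 Crows with
    | none => false
    | some P => P.length == n

/-- **The packed Gram certificate check, rows layout, fully SALTED / INDEXED**: salted symmetry, salted
expansion, indexed diagonal-dominance walk. Same function as `checkRowsI` (and as `checkRows`):
`checkRowsS_eq_checkRowsI`, `checkRowsS_eq_checkRows`. Discharge by `decide +kernel`. [folklore] -/
def checkRowsS (n w den v x O : ℕ) (Arows d Crows : List ℕ) : Bool :=
  let X := 2 ^ x
  let m := d.length
  decide (0 < den) && (Arows.length == n) && symmAllS w Arows 0 Arows &&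
    decide (m * maxList d * (2 * O) ^ 2 < X) &&
    match expandRowsS (2 ^ v) X (2 * O) d 0 Crows with
    | none => false
    | some P => (P.length == n) && ddRangeI n w X (X ^ (m - 1)) O (sumList d) P Arows n 0

/-- **One SALTED / INDEXED range of the rows check**: salted expansion, indexed walk over the rows
`lo … lo+cnt−1`. Same function as `checkRowsRangeI` (`checkRowsRangeS_eq`). [folklore] -/
def checkRowsRangeS (n w v x O : ℕ) (Arows d Crows : List ℕ) (lo cnt : ℕ) : Bool :=
  let X := 2 ^ x
  let m := d.length
  match expandRowsS (2 ^ v) X (2 * O) d 0 Crows with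
  | none => false
  | some P => (P.length == n) && ddRangeI n w X (X ^ (m - 1)) O (sumList d) P Arows cnt lo

/-- The salted head IS `checkRowsHead`. [cite: BlekhermanParriloThomas2012, App. A.1.2] -/
theorem checkRowsHeadS_eq (n w den v x O : ℕ) (Arows d Crows : List ℕ) :
    checkRowsHeadS n w den v x O Arows d Crows = checkRowsHead n w den v x O Arows d Crows := by
  cases h : expandRows (2 ^ v) (2 ^ x) (2 * O) d Crows <;>
    simp only [checkRowsHeadS, checkRowsHead, symmAllS_eq, expandRowsS_eq, h]

/-- The salted one-piece check IS `checkRowsI`. [cite: BlekhermanParriloThomas2012, App. A.1.2] -/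
theorem checkRowsS_eq_checkRowsI (n w den v x O : ℕ) (Arows d Crows : List ℕ) :
    checkRowsS n w den v x O Arows d Crows = checkRowsI n w den v x O Arows d Crows := by
  cases h : expandRows (2 ^ v) (2 ^ x) (2 * O) d Crows <;>
    simp only [checkRowsS, checkRowsI, symmAllS_eq, expandRowsS_eq, h]

/-- The salted one-piece check IS `checkRows`. [cite: BlekhermanParriloThomas2012, App. A.1.2] -/
theorem checkRowsS_eq_checkRows (n w den v x O : ℕ) (Arows d Crows : List ℕ) :
    checkRowsS n w den v x O Arows d Crows = checkRows n w den v x O Arows d Crows := by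
  rw [checkRowsS_eq_checkRowsI, checkRowsI_eq_checkRows]

/-- The salted range IS `checkRowsRangeI`. [cite: BlekhermanParriloThomas2012, App. A.1.2] -/
theorem checkRowsRangeS_eq (n w v x O : ℕ) (Arows d Crows : List ℕ) (lo cnt : ℕ) :
    checkRowsRangeS n w v x O Arows d Crows lo cnt = checkRowsRangeI n w v x O Arows d Crows lo cnt := by
  cases h : expandRows (2 ^ v) (2 ^ x) (2 * O) d Crows <;>
    simp only [checkRowsRangeS, checkRowsRangeI, expandRowsS_eq, h]

/-- **`checkRowsS ⇒ checkRows`** (what an emitter's `decide +kernel` feeds to every `checkRows`-stated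
theorem). [cite: BlekhermanParriloThomas2012, App. A.1.2] -/
theorem checkRows_of_checkRowsS {n w den v x O : ℕ} {Arows d Crows : List ℕ}
    (h : checkRowsS n w den v x O Arows d Crows = true) : checkRows n w den v x O Arows d Crows = true := by
  rwa [checkRowsS_eq_checkRows] at h

/-- **`checkRowsHeadS ⇒ checkRowsHead`**. [cite: BlekhermanParriloThomas2012, App. A.1.2] -/
theorem checkRowsHead_of_checkRowsHeadS {n w den v x O : ℕ} {Arows d Crows : List ℕ}
    (h : checkRowsHeadS n w den v x O Arows d Crows = true) :
    checkRowsHead n w den v x O Arows d Crows = true := by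
  rwa [checkRowsHeadS_eq] at h

/-- **`checkRowsRangeS ⇒ checkRowsRange`**. [cite: BlekhermanParriloThomas2012, App. A.1.2] -/
theorem checkRowsRange_of_checkRowsRangeS {n w v x O : ℕ} {Arows d Crows : List ℕ} {lo cnt : ℕ}
    (h : checkRowsRangeS n w v x O Arows d Crows lo cnt = true) :
    checkRowsRange w v x O Arows d Crows lo cnt = true :=
  checkRowsRange_of_checkRowsRangeI (by rwa [checkRowsRangeS_eq] at h)

/-- Test: the salted one-piece check on the `3 × 3` data, kernel. -/
example : checkRowsS 3 4 1 3 7 2 testI_A [1, 1, 1] testI_C = true := by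
  decide +kernel

/-- Test: salted head + two salted ranges feed `isGramCertZ_of_checkRowsRanges`. -/
example : IsGramCertZ (intMatrixRows 3 4 testI_A) (weights [1, 1, 1]) (factorRows 3 2 [1, 1, 1] testI_C 3) :=
  isGramCertZ_of_checkRowsRanges (den := 1) (x := 7) (cnts := [2, 1])
    (checkRowsHead_of_checkRowsHeadS (by decide +kernel))
    ⟨checkRowsRange_of_checkRowsRangeS (n := 3) (by decide +kernel),
     checkRowsRange_of_checkRowsRangeS (n := 3) (by decide +kernel), trivial⟩ (by norm_num)

/-- Test: the planted defect is rejected by the salted check. -/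
example : checkRowsS 3 4 1 3 7 2 [2170, 1959, 2424] [1, 1, 1] testI_C = false := by
  decide +kernel

end PSD.Packed

end Literature.Computation.Certificates
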